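import Literature.NumberTheory.ComplexMultiplication.CMTypeRankTwoBlocks
import HarnessLib

/-!
# Two-block CM types: ONE partial conjugation already gives rank additivity `rank(Σ₁ ⊔ Σ₂) + 1 = rank Σ₁ + rank Σ₂`

Sequel of `NumberTheory/ComplexMultiplication/CMTypeRankTwoBlocks` (two `G`-sets `E₁`, `E₂` with CM types `Σ₁`, `Σ₂`
for the conjugation `ρ`, glued type `{z | Sum.elim (· ∈ Σ₁) (· ∈ Σ₂) z}` on `E₁ ⊕ E₂`; there: `rank(Σ₁ ⊔ Σ₂) + 1 ≤
rank Σ₁ + rank Σ₂` always, equality under BLOCKWISE INDEPENDENCE — every `g` agrees on `E₁` with some `g₁` trivial on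
`E₂`).  Here the hypothesis is weakened to the existence of a SINGLE element: a PARTIAL CONJUGATION `σ ∈ G`, acting as
`ρ` on `E₁` and trivially on `E₂` (Gordon's "`σ ∈ 𝒢` that acts as `+1` on `X(K^×_{1,1})` and `−1` on the other components"
in the proof of the theorem of Imai–Murty; the two-block form of the tree's `typeRank_sigmaType_add_card_eq_of_partialConj`
for `Sigma`-indexed families):

* **`typeRank_sum_add_one_eq_of_partialConj`** — `∃ σ, (σ = ρ on E₁) ∧ (σ = 1 on E₂)` ⟹ `rank(Σ₁ ⊔ Σ₂) + 1 =
  rank Σ₁ + rank Σ₂`.  Proof: for every `g` the pair `(u¹_{gσ}, u²_{gσ}) = (−u¹_g, u²_g)` belongs to the antisymmetric span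
  of the glued type together with `(u¹_g, u²_g)`, hence so do `(u¹_g, 0)` and `(0, u²_g)`: `U(Σ₁ ⊔ Σ₂) = U(Σ₁) × U(Σ₂)`.
* **`typeRank_sum_add_one_eq_of_partialConj'`** — the same with `σ` trivial on `E₁` and `ρ` on `E₂`.

For `G = Aut(ℂ)` on the embeddings of two families of CM fields a partial conjugation exists iff complex conjugation fixes
the intersection of the composita of the Galois closures, i.e. iff the Galois closures MEET IN A TOTALLY REAL FIELD
(`…/PartialConjugationOfRealIntersection`); the consumer on abelian varieties is
`Pohlmann1968/HodgeClassesProductSpanCMProductsRealIntersection`.  No definition, no named fact.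

## References
* [Gordon1999HodgeAVSurvey] B. B. Gordon, *A survey of the Hodge conjecture for abelian varieties*, §3 Theorem (Imai,
  Murty) with proof.
* [MoonenZarhin1999LowDim] B. Moonen, Yu. Zarhin, Math. Ann. 315 (1999) 711–733, §3 (3.1).
-/

set_option autoImplicit false

noncomputable section

open scoped BigOperators

namespace Literature.NumberTheory.ComplexMultiplication

variable {G : Type*} [Group G] {E₁ E₂ : Type*} [MulAction G E₁] [MulAction G E₂]
  {Φ₁ : Set E₁} {Φ₂ : Set E₂} {ρ : G}

/-- **Blockwise independence is a special case**: it supplies the partial conjugation `σ := g₁(ρ)` (the element agreeing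
with `ρ` on `E₁` and trivial on `E₂`), so `typeRank_sum_add_one_eq_of_partialConj` below recovers
`typeRank_sum_add_one_eq_of_blockwise`. [cite: Gordon1999HodgeAVSurvey, §3 Theorem (Imai, Murty), proof] -/
theorem exists_partialConj_of_blockwise
    (hind : ∀ g : G, ∃ g₁ : G, (∀ x : E₁, g₁ • x = g • x) ∧ ∀ y : E₂, g₁ • y = y) :
    ∃ σ : G, (∀ x : E₁, σ • x = ρ • x) ∧ ∀ y : E₂, σ • y = y :=
  hind ρ

/-- If `σ` acts as `ρ` on `E₁` then `u¹_{gσ} = −u¹_g` (the translate by `gσ` is the complement of the translate by `g`).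
[cite: Shimura1998, §32.10 (proof)] -/
private theorem antiVec_mul_eq_neg_of_smul_eq_rho (h₁ : IsCMTypeWith ρ Φ₁) {σ : G}
    (hσ : ∀ x : E₁, σ • x = ρ • x) (g : G) : antiVec Φ₁ (g * σ) = -antiVec Φ₁ g := by
  rw [← h₁.antiVec_mul_rho g]
  funext x
  show 2 * translateInd Φ₁ (g * σ) x - 1 = 2 * translateInd Φ₁ (g * ρ) x - 1
  rw [translateInd_mul, translateInd_mul, hσ x]

/-- If `σ` acts trivially on `E₂` then `u²_{gσ} = u²_g`. [folklore] -/
private theorem antiVec_mul_eq_of_smul_eq_self {σ : G} (hσ : ∀ y : E₂, σ • y = y) (g : G) :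
    antiVec Φ₂ (g * σ) = antiVec Φ₂ g := by
  funext y
  show 2 * translateInd Φ₂ (g * σ) y - 1 = 2 * translateInd Φ₂ g y - 1
  rw [translateInd_mul, hσ y]

/-- If the span `W` of the pairs `(u¹_g, u²_g)` also contains all `(−u¹_g, u²_g)`, then `W ⊇ U(Σ₁) × U(Σ₂)`. [folklore] -/
private theorem prod_le_span_pair_of_neg_mem
    (hneg : ∀ g : G, (-antiVec Φ₁ g, antiVec Φ₂ g) ∈
      Submodule.span ℚ (Set.range fun g : G => (antiVec Φ₁ g, antiVec Φ₂ g))) :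
    (antiSpan G Φ₁).prod (antiSpan G Φ₂) ≤ Submodule.span ℚ (Set.range fun g : G => (antiVec Φ₁ g, antiVec Φ₂ g)) := by
  set W := Submodule.span ℚ (Set.range fun g : G => (antiVec Φ₁ g, antiVec Φ₂ g)) with hW
  have hpair : ∀ g : G, (antiVec Φ₁ g, antiVec Φ₂ g) ∈ W := fun g => Submodule.subset_span ⟨g, rfl⟩
  have hright : ∀ g : G, ((0 : E₁ → ℚ), antiVec Φ₂ g) ∈ W := fun g => by
    have : ((0 : E₁ → ℚ), antiVec Φ₂ g) = (1 / 2 : ℚ) • ((antiVec Φ₁ g, antiVec Φ₂ g) + (-antiVec Φ₁ g, antiVec Φ₂ g)) := by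
      rw [Prod.mk_add_mk, add_neg_cancel, Prod.smul_mk, smul_zero, ← two_smul ℚ (antiVec Φ₂ g), smul_smul]
      norm_num
    rw [this]
    exact W.smul_mem _ (W.add_mem (hpair g) (hneg g))
  have hleft : ∀ g : G, (antiVec Φ₁ g, (0 : E₂ → ℚ)) ∈ W := fun g => by
    have : (antiVec Φ₁ g, (0 : E₂ → ℚ)) = (antiVec Φ₁ g, antiVec Φ₂ g) - ((0 : E₁ → ℚ), antiVec Φ₂ g) := by
      rw [Prod.mk_sub_mk, sub_zero, sub_self]
    rw [this]
    exact W.sub_mem (hpair g) (hright g)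
  rw [LinearMap.prod_eq_sup_map]
  refine sup_le ?_ ?_
  · rw [antiSpan, Submodule.map_span, Submodule.span_le]
    rintro _ ⟨_, ⟨g, rfl⟩, rfl⟩
    exact hleft g
  · rw [antiSpan, Submodule.map_span, Submodule.span_le]
    rintro _ ⟨_, ⟨g, rfl⟩, rfl⟩
    exact hright g

variable [Fintype E₁] [Fintype E₂]

/-- `dim (p × q) = dim p + dim q` for submodules of the two weight spaces. [folklore] -/
private theorem finrank_prod_eq' (p : Submodule ℚ (E₁ → ℚ)) (q : Submodule ℚ (E₂ → ℚ)) :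
    Module.finrank ℚ (p.prod q) = Module.finrank ℚ p + Module.finrank ℚ q := by
  have hinj : Function.Injective (p.subtype.prodMap q.subtype) := by
    rintro ⟨a, b⟩ ⟨a', b'⟩ h
    simp only [LinearMap.prodMap_apply, Submodule.subtype_apply, Prod.mk.injEq] at h
    exact Prod.ext (Subtype.ext h.1) (Subtype.ext h.2)
  have hrange : LinearMap.range (p.subtype.prodMap q.subtype) = p.prod q := by
    rw [LinearMap.range_prodMap, Submodule.range_subtype, Submodule.range_subtype]
  rw [← hrange, LinearMap.finrank_range_of_inj hinj, Module.finrank_prod]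

/-- `U(Σ₁) × U(Σ₂) ≤ W` forces rank additivity (with `rank(Σ₁ ⊔ Σ₂) + 1 ≤ rank Σ₁ + rank Σ₂`). [folklore] -/
private theorem typeRank_sum_add_one_eq_of_prod_le [Nonempty E₁] [Nonempty E₂] (h₁ : IsCMTypeWith ρ Φ₁)
    (h₂ : IsCMTypeWith ρ Φ₂)
    (hle : (antiSpan G Φ₁).prod (antiSpan G Φ₂) ≤
      Submodule.span ℚ (Set.range fun g : G => (antiVec Φ₁ g, antiVec Φ₂ g))) :
    typeRank G {z : E₁ ⊕ E₂ | Sum.elim (· ∈ Φ₁) (· ∈ Φ₂) z} + 1 = typeRank G Φ₁ + typeRank G Φ₂ := by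
  refine le_antisymm (typeRank_sum_add_one_le h₁ h₂) ?_
  rw [(h₁.sum h₂).typeRank_eq_finrank_antiSpan_add_one, h₁.typeRank_eq_finrank_antiSpan_add_one,
    h₂.typeRank_eq_finrank_antiSpan_add_one]
  have h := Submodule.finrank_mono hle
  rw [finrank_prod_eq', ← map_antiSpan_sum_eq_span, LinearEquiv.finrank_map_eq] at h
  omega

/-- **A partial conjugation on the first block gives rank additivity.**  If some `σ ∈ G` acts as the conjugation `ρ` on
`E₁` and trivially on `E₂`, then `rank(Σ₁ ⊔ Σ₂) + 1 = rank Σ₁ + rank Σ₂` (`Hg(X × Y) = Hg(X) × Hg(Y)`): for every `g`,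
`(u¹_{gσ}, u²_{gσ}) = (−u¹_g, u²_g)` lies in `U(Σ₁ ⊔ Σ₂)` with `(u¹_g, u²_g)`, so `U(Σ₁ ⊔ Σ₂) = U(Σ₁) × U(Σ₂)` — Gordon's
element "acting as `+1` on `X(K^×_{1,1})` and `−1` on the other components", for arbitrary CM types and one element only.
[cite: Gordon1999HodgeAVSurvey, §3 Theorem (Imai, Murty), proof] -/
theorem typeRank_sum_add_one_eq_of_partialConj [Nonempty E₁] [Nonempty E₂] (h₁ : IsCMTypeWith ρ Φ₁)
    (h₂ : IsCMTypeWith ρ Φ₂) (hσ : ∃ σ : G, (∀ x : E₁, σ • x = ρ • x) ∧ ∀ y : E₂, σ • y = y) :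
    typeRank G {z : E₁ ⊕ E₂ | Sum.elim (· ∈ Φ₁) (· ∈ Φ₂) z} + 1 = typeRank G Φ₁ + typeRank G Φ₂ := by
  obtain ⟨σ, hσ₁, hσ₂⟩ := hσ
  refine typeRank_sum_add_one_eq_of_prod_le h₁ h₂ (prod_le_span_pair_of_neg_mem fun g => ?_)
  rw [← antiVec_mul_eq_neg_of_smul_eq_rho h₁ hσ₁ g, ← antiVec_mul_eq_of_smul_eq_self (Φ₂ := Φ₂) hσ₂ g]
  exact Submodule.subset_span ⟨g * σ, rfl⟩

/-- **A partial conjugation on the second block gives rank additivity**: some `σ ∈ G` trivial on `E₁` and acting as `ρ`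
on `E₂`. [cite: Gordon1999HodgeAVSurvey, §3 Theorem (Imai, Murty), proof] -/
theorem typeRank_sum_add_one_eq_of_partialConj' [Nonempty E₁] [Nonempty E₂] (h₁ : IsCMTypeWith ρ Φ₁)
    (h₂ : IsCMTypeWith ρ Φ₂) (hσ : ∃ σ : G, (∀ x : E₁, σ • x = x) ∧ ∀ y : E₂, σ • y = ρ • y) :
    typeRank G {z : E₁ ⊕ E₂ | Sum.elim (· ∈ Φ₁) (· ∈ Φ₂) z} + 1 = typeRank G Φ₁ + typeRank G Φ₂ := by
  obtain ⟨σ, hσ₁, hσ₂⟩ := hσ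
  refine typeRank_sum_add_one_eq_of_prod_le h₁ h₂ (prod_le_span_pair_of_neg_mem fun g => ?_)
  -- `(u¹_{gσ}, u²_{gσ}) = (u¹_g, −u²_g)`, so `(−u¹_g, u²_g) = −(u¹_{gσ}, u²_{gσ})`
  have hpair : (antiVec Φ₁ g, -antiVec Φ₂ g) ∈
      Submodule.span ℚ (Set.range fun g : G => (antiVec Φ₁ g, antiVec Φ₂ g)) := by
    rw [← antiVec_mul_eq_neg_of_smul_eq_rho h₂ hσ₂ g, ← antiVec_mul_eq_of_smul_eq_self (Φ₂ := Φ₁) hσ₁ g]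
    exact Submodule.subset_span ⟨g * σ, rfl⟩
  have : (-antiVec Φ₁ g, antiVec Φ₂ g) = -(antiVec Φ₁ g, -antiVec Φ₂ g) := by
    rw [Prod.neg_mk, neg_neg]
  rw [this]
  exact Submodule.neg_mem _ hpair

end Literature.NumberTheory.ComplexMultiplication

end
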